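import Literature.Geometry.Kaehler.RiemannianHodgeSmoothCounterexample
import HarnessLib

/-!
# `isSmoothForm_mcoderiv` is false as a closed statement: the universal closure

Companion of `Literature/Geometry/Kaehler/RiemannianHodge.lean` (§*Smoothness predicates*) and
`Literature/Geometry/Kaehler/RiemannianHodgeSmoothCounterexample.lean`, on the pattern of
`RiemannianHodgeHarmonicRefutation.lean` (which does the same for `mem_harmonicForms_iff`).

`Literature.Geometry.Kaehler.isSmoothForm_mcoderiv o` records Warner's "we define an operator
`δ` from `p`-forms to `(p-1)` forms by setting `δ = (-1)^{n(p+1)+1} *d*`" (GTM 94, 6.1 (2),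
p. 220; an operator on the smooth forms `E^p(M)`, `*` being smooth by 4.10 (6), p. 150, for the
*smooth* metrics of 4.10, p. 149) as the predicate "whenever the volume form of `o` is smooth,
`δ` maps smooth `(k+1)`-forms of `(M, g, o)` to smooth `k`-forms", `g` being the ambient
`[RiemannianBundle (TangentSpace I)]` instance — a fibrewise family of inner products with no
regularity in the base point. Its elaborated binders are exactly
`{E} [NormedAddCommGroup E] [NormedSpace ℝ E] {n} [Fact (finrank ℝ E = n)] {H} [TopologicalSpace H]
 {I} {M} [TopologicalSpace M] [ChartedSpace H M] [FiniteDimensional ℝ E]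
 [RiemannianBundle (TangentSpace I)] {k m} (o)`
(no `IsManifold`, no continuity or smoothness of the metric). The prove-seat verdict on the
former *closed* named fact of that name was **refuted as declared**:
`RiemannianHodgeSmoothCounterexample.lean` builds the step metric `g = diag(λ, λ⁻¹)` on `ℝ²`
(`λ = 1` on `{x₁ ≤ 0}`, `2` on `{x₁ > 0}`; unit determinant, so `vol = dx₀ ∧ dx₁` is smooth and
the hypothesis `ho` holds) for which `δ(x₀ · vol) = -λ⁻¹ dx₁` is discontinuous
(`StepMetric.not_isSmoothForm_mcoderiv_stepMetric`, the instance `k = 1`, `m = 0`; closure over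
`M`, metric and `o` at `E = H = ℝ²`: `not_forall_isSmoothForm_mcoderiv`).

This file only records that certificate under the canonical name
`Literature.Geometry.Kaehler.not_isSmoothForm_mcoderiv`: the negation of the closure of the
predicate over **exactly the binders it elaborates with** (types in `Type`), reduced in one line
to `not_forall_isSmoothForm_mcoderiv`. Nothing new is computed here.

**What is true.** Under the intended hypotheses (`[IsManifold I ∞ M]`,
`[IsContMDiffRiemannianBundle I ∞ E (TangentSpace I)]`) the predicate holds and is proved in the
tree: `isSmoothForm_mcoderiv_of_contMDiffMetric` (`RiemannianHodgeSmoothProofs.lean`, from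
`IsSmoothForm.mcoderiv`); the correctly *closed* named fact is
`isSmoothForm_mcoderiv_of_isContMDiffRiemannianBundle`, discharged by `…_holds`
(`RiemannianHodgeCodiffSmoothFact.lean`).

## References

* F. W. Warner, *Foundations of Differentiable Manifolds and Lie Groups*, GTM 94 (1983): 4.10
  (pp. 149–150, (6)), 6.1 (2) (p. 220).
-/

open scoped Manifold ContDiff
open Bundle Module

namespace Literature.Geometry.Kaehler

/-- **The predicate `isSmoothForm_mcoderiv` is false as a closed statement.** Closed universally
over exactly the binders it elaborates with — a normed space `E` with `finrank ℝ E = n`, a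
charted space `M` over any model with corners `I` (no `IsManifold`), a fibrewise
`RiemannianBundle` structure on the tangent spaces (no continuity or smoothness in the base
point), degrees `(k + 1) + m = n` and an orientation family `o` — the statement "`δα` is smooth
for every smooth `(k+1)`-form `α` whenever the volume form of `o` is smooth" fails. Witness:
`E = H = M = ℝ²` (`Fin 2 → ℝ`), `I = 𝓘(ℝ, ℝ²)`, `n = 2`, `k = 1`, `m = 0`, the step metric
`StepMetric.bundle` (`g = diag(λ, λ⁻¹)`, `λ ∈ {1, 2}` a step function) with the standard
orientation: `δ(x₀ · vol) = -λ⁻¹ dx₁` is discontinuous across `{x₁ = 0}`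
(`StepMetric.not_isSmoothForm_mcoderiv_stepMetric`, `not_forall_isSmoothForm_mcoderiv`). The
intended smooth-metric statement (Warner (1983), 6.1 (2), p. 220, with 4.10 (6), p. 150) is the
proved `isSmoothForm_mcoderiv_of_contMDiffMetric` / the discharged closed fact
`isSmoothForm_mcoderiv_of_isContMDiffRiemannianBundle`. [folklore] -/
theorem not_isSmoothForm_mcoderiv :
    ¬ ∀ {E : Type} [NormedAddCommGroup E] [NormedSpace ℝ E] {n : ℕ} [Fact (finrank ℝ E = n)]
        {H : Type} [TopologicalSpace H] {I : ModelWithCorners ℝ E H}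
        {M : Type} [TopologicalSpace M] [ChartedSpace H M] [FiniteDimensional ℝ E]
        [RiemannianBundle (fun x : M ↦ TangentSpace I x)] {k m : ℕ}
        (o : (x : M) → Orientation ℝ (TangentSpace I x) (Fin n)),
        isSmoothForm_mcoderiv (k := k) (m := m) o :=
  fun H ↦ not_forall_isSmoothForm_mcoderiv fun M _ _ _ o ↦
    @H StepMetric.P _ _ 2 StepMetric.factFinrank StepMetric.P _ 𝓘(ℝ, StepMetric.P) M _ _ _ _ 1 0 o

end Literature.Geometry.Kaehler
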